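import Summits.AtomisticToContinuum.Crystallization.Theorems.FreeSplittingCertificatesStrictSplittingRuleP1TableCov

/-!
# `StrictSplittingRule` (stmt-AtomisticToContinuum-12560): `(1+r)⁻⁶` DECAY of the matched table weights (P1 interpolant object, part 18)

Route `FreeSplittingCertificates`, crux r3 `StrictSplittingRule` (H12⋆ = `stub_coreJointCoercive`), unit b2b-freesplit-B gen 22.
VALUE = the decay clause `|M b (q − p) s s'| ≤ C·(1 + ‖y_q − y_p‖)⁻⁶` of `CoreJointCoercive` for the matched receipts table of parts
16–17, when the site-centred weight `g` (`W_p(i) = ∫_{cell i} g(y − y_p)`) obeys `0 ≤ g(z) ≤ M·(S₁ + |z|²)⁻³` — which the ledger's split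
weight `χ²|z|⁻⁶`, `χ = fpChi S₁ S₂` (`0 < S₁ < S₂`), does with `M = 8` (`chiSq_invPow_le`):
* `fpSmoothstep_mem_Icc` (`0 ≤ S ≤ 1`), `chiSq_invPow_le`;
* `p1SiteW_le` — a cell weight is at most `|cell|·M·(S₁ + dist₊²)⁻³` (cell within sup-distance `2|a|+|h|` of its cube-origin site);
* `p1SlotW_le`, `p1BondW_le_of_cellBound` — a bond weight is at most `240·Σ_{corners} (cube bound)`;
* **`p1BondW_p1SiteW_decay`**: `∃ C, ∀ p q d, 0 ≤ p1BondW W_p q d ≤ C·((1 + ‖y_q − y_p‖)⁻¹)⁶` (hcp ratio-free; `a, h > 0`).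
NOT a proof of H12⋆, NOT summit progress.  [folklore]
-/

noncomputable section

open Set Function Metric MeasureTheory Filter Topology
open scoped BigOperators NNReal ENNReal

namespace Summit.AtomisticToContinuum.Crystallization.Theorems.StrictSplittingRuleBirth

open Literature.MathematicalPhysics.StatisticalMechanics
open Summit.AtomisticToContinuum.Crystallization.Theorems.PalmUnimodularRigidity.LayeredLawsSelectHcp

/-! ## The split weight is dominated by `8·(S₁ + |z|²)⁻³` -/

/-- The quintic smoothstep takes values in `[0, 1]`. -/
theorem fpSmoothstep_mem_Icc (t : ℝ) : fpSmoothstep t ∈ Icc (0 : ℝ) 1 := by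
  rcases le_or_gt t 0 with h0 | h0
  · rw [fpSmoothstep_of_nonpos h0]; exact ⟨le_rfl, zero_le_one⟩
  rcases le_or_gt 1 t with h1 | h1
  · rw [fpSmoothstep_of_one_le h1]; exact ⟨zero_le_one, le_rfl⟩
  rw [fpSmoothstep_of_mem h0.le h1.le]
  have hq : 0 ≤ 10 - 15 * t + 6 * t ^ 2 := by nlinarith [sq_nonneg (t - 5 / 4)]
  refine ⟨by positivity, ?_⟩
  have e : 1 - t ^ 3 * (10 - 15 * t + 6 * t ^ 2) = (1 - t) ^ 3 * (6 * t ^ 2 + 3 * t + 1) := by ring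
  have h2 : 0 ≤ (1 - t) ^ 3 * (6 * t ^ 2 + 3 * t + 1) :=
    mul_nonneg (pow_nonneg (by linarith) 3) (by positivity)
  linarith

/-- **The ledger's split weight is dominated**: `χ(z)²·|z|⁻⁶ ≤ 8·(S₁ + |z|²)⁻³` for `χ = fpChi S₁ S₂`, `0 < S₁ < S₂`
(`χ = 0` inside `|z|² ≤ S₁`, `χ² ≤ 1` and `|z|⁻² ≤ 2(S₁ + |z|²)⁻¹` outside). -/
theorem chiSq_invPow_le {S1 S2 : ℝ} (h1 : 0 < S1) (hlt : S1 < S2) (z : Fin 3 → ℝ) :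
    fpChi S1 S2 z ^ 2 * (fpSq z)⁻¹ ^ 3 ≤ 8 * (S1 + fpSq z)⁻¹ ^ 3 := by
  have hs0 := fpSq_nonneg z
  by_cases hz : fpSq z ≤ S1
  · rw [fpChi_eq_zero hlt hz, zero_pow two_ne_zero, zero_mul]
    positivity
  push Not at hz
  have hs : 0 < fpSq z := h1.trans hz
  have hχ := fpSmoothstep_mem_Icc ((fpSq z - S1) / (S2 - S1))
  have hχ2 : fpChi S1 S2 z ^ 2 ≤ 1 := by
    unfold fpChi
    nlinarith [hχ.1, hχ.2]
  have h2 : (fpSq z)⁻¹ ≤ 2 * (S1 + fpSq z)⁻¹ := by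
    rw [← one_div, ← div_eq_mul_inv, div_le_div_iff₀ hs (by positivity)]
    linarith
  have h3 : (fpSq z)⁻¹ ^ 3 ≤ (2 * (S1 + fpSq z)⁻¹) ^ 3 := pow_le_pow_left₀ (by positivity) h2 3
  have h4 : 0 ≤ (fpSq z)⁻¹ ^ 3 := by positivity
  calc fpChi S1 S2 z ^ 2 * (fpSq z)⁻¹ ^ 3 ≤ 1 * (2 * (S1 + fpSq z)⁻¹) ^ 3 :=
        mul_le_mul hχ2 h3 h4 zero_le_one
    _ = 8 * (S1 + fpSq z)⁻¹ ^ 3 := by ring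

/-! ## Cell weights -/

/-- **Cell weight bound**: for `0 ≤ g ≤ M·(S₁ + |z|²)⁻³`, the weight of cell `(n, π)` centred at site `p` is at most
`|cell|·M·(S₁ + ρ²)⁻³`, `ρ = (‖y_n − y_p‖_∞ − (2|a|+|h|))₊`. -/
theorem p1SiteW_le {a h : ℝ} (ha : 0 < a) (hh : 0 < h) {g : (Fin 3 → ℝ) → ℝ} {M S1 : ℝ} (hM : 0 ≤ M) (hS1 : 0 < S1)
    (hgM : ∀ z, g z ≤ M * (S1 + fpSq z)⁻¹ ^ 3) (hg0 : ∀ z, 0 ≤ g z) (p n : ℤ × ℤ × ℤ) (π : Fin 6) :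
    p1SiteW a h g p (n, π) ≤ √3 * a ^ 2 * h / 12 *
      (M * (S1 + max (‖(fun k => hcpSite a h n k) - (fun k => hcpSite a h p k)‖ - (2 * |a| + |h|)) 0 ^ 2)⁻¹ ^ 3) := by
  have hρ0 : 0 ≤ max (‖(fun k => hcpSite a h n k) - (fun k => hcpSite a h p k)‖ - (2 * |a| + |h|)) 0 := le_max_right _ _
  -- pointwise bound on the cell
  have hpt : ∀ y ∈ p1RealCell a h (n, π), ‖g (y - fun k => hcpSite a h p k)‖ ≤
      M * (S1 + max (‖(fun k => hcpSite a h n k) - (fun k => hcpSite a h p k)‖ - (2 * |a| + |h|)) 0 ^ 2)⁻¹ ^ 3 := by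
    intro y hy
    rw [Real.norm_eq_abs, abs_of_nonneg (hg0 _)]
    refine (hgM _).trans (mul_le_mul_of_nonneg_left ?_ hM)
    have hyn : ‖y - fun k => hcpSite a h n k‖ ≤ 2 * |a| + |h| := by
      simpa using norm_sub_le_of_mem_p1RealCell (i := (n, π)) ha.ne' hh.ne' hy
    have htri := norm_sub_le_norm_sub_add_norm_sub (fun k => hcpSite a h n k) y (fun k => hcpSite a h p k)
    rw [norm_sub_rev (fun k => hcpSite a h n k) y] at htri
    have hlow : max (‖(fun k => hcpSite a h n k) - (fun k => hcpSite a h p k)‖ - (2 * |a| + |h|)) 0 ≤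
        ‖y - fun k => hcpSite a h p k‖ := max_le (by linarith) (norm_nonneg _)
    have hsq : max (‖(fun k => hcpSite a h n k) - (fun k => hcpSite a h p k)‖ - (2 * |a| + |h|)) 0 ^ 2 ≤
        fpSq (y - fun k => hcpSite a h p k) := (pow_le_pow_left₀ hρ0 hlow 2).trans (norm_sq_le_fpSq _)
    have hinv : (S1 + fpSq (y - fun k => hcpSite a h p k))⁻¹ ≤
        (S1 + max (‖(fun k => hcpSite a h n k) - (fun k => hcpSite a h p k)‖ - (2 * |a| + |h|)) 0 ^ 2)⁻¹ :=
      inv_anti₀ (by positivity) (by linarith)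
    have hf0 := fpSq_nonneg (y - fun k => hcpSite a h p k)
    exact pow_le_pow_left₀ (inv_nonneg.2 (by linarith)) hinv 3
  have hvol : volume (p1RealCell a h (n, π)) < ∞ := by
    rw [volume_p1RealCell ha hh]
    exact ENNReal.ofReal_lt_top
  have key := norm_setIntegral_le_of_norm_le_const (f := fun y => g (y - fun k => hcpSite a h p k)) hvol hpt
  rw [measureReal_def, volume_real_p1RealCell ha hh, Real.norm_eq_abs] at key
  have := le_abs_self (∫ y in p1RealCell a h (n, π), g (y - fun k => hcpSite a h p k))
  unfold p1SiteW
  linarith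

/-! ## Bond weights from cube bounds -/

/-- A slot weight is at most `|ι| ·` the sum of its (nonnegative) cube coefficients over the corners. -/
theorem p1SlotW_le {ι : Type*} [Fintype ι] (τ η : Bool → ι → ℤ × ℤ × ℤ) {c : ℤ × ℤ × ℤ → ℝ} (hc : ∀ n, 0 ≤ c n)
    (q d : ℤ × ℤ × ℤ) : p1SlotW τ η c q d ≤ ∑ o ∈ p1Corners, (Fintype.card ι : ℝ) * c (q - o) := by
  unfold p1SlotW
  refine Finset.sum_le_sum fun o _ => ?_
  calc (∑ i, if τ (p1Par (q - o)) i = o ∧ η (p1Par (q - o)) i = o + d then c (q - o) else 0)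
      ≤ ∑ _i : ι, c (q - o) := Finset.sum_le_sum fun i _ => by split_ifs <;> [exact le_rfl; exact hc _]
    _ = (Fintype.card ι : ℝ) * c (q - o) := by rw [Finset.sum_const, nsmul_eq_mul, Finset.card_univ]

/-- Slot weights of nonnegative coefficients are nonnegative. -/
theorem p1SlotW_nonneg {ι : Type*} [Fintype ι] (τ η : Bool → ι → ℤ × ℤ × ℤ) {c : ℤ × ℤ × ℤ → ℝ} (hc : ∀ n, 0 ≤ c n)
    (q d : ℤ × ℤ × ℤ) : 0 ≤ p1SlotW τ η c q d :=
  Finset.sum_nonneg fun o _ => Finset.sum_nonneg fun i _ => by split_ifs <;> [exact hc _; exact le_rfl]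

/-- **Bond weights are nonnegative** for nonnegative cell weights. -/
theorem p1BondW_nonneg {W : (ℤ × ℤ × ℤ) × Fin 6 → ℝ} (hW : ∀ i, 0 ≤ W i) (q d : ℤ × ℤ × ℤ) : 0 ≤ p1BondW W q d := by
  have hm : ∀ n, 0 ≤ p1OctW W n := fun n => by unfold p1OctW; exact le_max_of_le_left (le_max_of_le_left (hW (n, 2)))
  unfold p1BondW
  exact add_nonneg (add_nonneg (p1SlotW_nonneg _ _ (fun n => by linarith [hW (n, 0)]) q d)
    (p1SlotW_nonneg _ _ (fun n => by linarith [hW (n, 1)]) q d)) (p1SlotW_nonneg _ _ (fun n => by linarith [hm n]) q d)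

/-- **Bond weight from a cube bound**: if every cell weight of cube `n` is at most `B n` (`W ≥ 0`), then
`p1BondW W q d ≤ 240·Σ_{o ∈ corners} B(q − o)`. -/
theorem p1BondW_le_of_cellBound {W : (ℤ × ℤ × ℤ) × Fin 6 → ℝ} {B : ℤ × ℤ × ℤ → ℝ} (hW : ∀ i, 0 ≤ W i)
    (hWB : ∀ n π, W (n, π) ≤ B n) (q d : ℤ × ℤ × ℤ) : p1BondW W q d ≤ 240 * ∑ o ∈ p1Corners, B (q - o) := by
  have hm : ∀ n, 0 ≤ p1OctW W n := fun n => by unfold p1OctW; exact le_max_of_le_left (le_max_of_le_left (hW (n, 2)))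
  have hmB : ∀ n, p1OctW W n ≤ B n := fun n => by
    unfold p1OctW
    exact max_le (max_le (hWB n 2) (hWB n 3)) (max_le (hWB n 4) (hWB n 5))
  have e0 := p1SlotW_le (fun b => p1TetTail b 0) (fun b => p1TetHead b 0) (c := fun n => 4 * W (n, 0))
    (fun n => by linarith [hW (n, 0)]) q d
  have e1 := p1SlotW_le (fun b => p1TetTail b 1) (fun b => p1TetHead b 1) (c := fun n => 4 * W (n, 1))
    (fun n => by linarith [hW (n, 1)]) q d
  have e2 := p1SlotW_le p1OctTail p1OctHead (c := fun n => 16 * p1OctW W n) (fun n => by linarith [hm n]) q d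
  simp only [Fintype.card_fin, Nat.cast_ofNat] at e0 e1 e2
  unfold p1BondW
  have s : ∑ o ∈ p1Corners, (6 : ℝ) * (4 * W (q - o, 0)) + ∑ o ∈ p1Corners, (6 : ℝ) * (4 * W (q - o, 1)) +
      ∑ o ∈ p1Corners, (12 : ℝ) * (16 * p1OctW W (q - o)) ≤ 240 * ∑ o ∈ p1Corners, B (q - o) := by
    rw [← Finset.sum_add_distrib, ← Finset.sum_add_distrib, Finset.mul_sum]
    refine Finset.sum_le_sum fun o _ => ?_
    linarith [hWB (q - o) 0, hWB (q - o) 1, hmB (q - o)]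
  linarith

/-! ## The decay theorem -/

/-- Cube-origin sites near a corner: `‖y_{q−o} − y_p‖_∞ ≥ ‖y_q − y_p‖_∞ − (2|a|+|h|)` for a corner `o`. -/
theorem norm_sub_corner_ge (a h : ℝ) (p q o : ℤ × ℤ × ℤ) (ho : o ∈ p1Corners) :
    ‖(fun k => hcpSite a h q k) - (fun k => hcpSite a h p k)‖ - (2 * |a| + |h|) ≤
      ‖(fun k => hcpSite a h (q - o) k) - (fun k => hcpSite a h p k)‖ := by
  have hc : ‖(fun k => hcpSite a h q k) - (fun k => hcpSite a h (q - o) k)‖ ≤ 2 * |a| + |h| := by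
    refine (pi_norm_le_iff_of_nonneg (by positivity)).2 fun k => ?_
    rw [Pi.sub_apply, Real.norm_eq_abs]
    have := abs_hcpSite_corner_sub_le a h (q - o) o ((mem_p1Corners_iff o).1 ho) k
    rwa [sub_add_cancel] at this
  have := norm_sub_le_norm_sub_add_norm_sub (fun k => hcpSite a h q k) (fun k => hcpSite a h (q - o) k) (fun k => hcpSite a h p k)
  linarith

/-- The Euclidean distance of two sites is at most twice the sup distance of their coordinate functions. -/
theorem norm_hcpSite_sub_le_two_mul (a h : ℝ) (p q : ℤ × ℤ × ℤ) :
    ‖hcpSite a h q - hcpSite a h p‖ ≤ 2 * ‖(fun k => hcpSite a h q k) - (fun k => hcpSite a h p k)‖ := by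
  set f : Fin 3 → ℝ := (fun k => hcpSite a h q k) - (fun k => hcpSite a h p k) with hf
  have hk : ∀ k, |hcpSite a h q k - hcpSite a h p k| ≤ ‖f‖ := fun k => by
    have : |f k| ≤ ‖f‖ := by rw [← Real.norm_eq_abs]; exact norm_le_pi_norm f k
    simpa [hf] using this
  have hn : 0 ≤ ‖f‖ := norm_nonneg _
  have hsq : ‖hcpSite a h q - hcpSite a h p‖ ^ 2 ≤ (2 * ‖f‖) ^ 2 := by
    rw [← real_inner_self_eq_norm_sq, PhononStabilityCWC.Cert.inner_fin3]
    simp only [PiLp.sub_apply]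
    have h0 := hk 0; have h1 := hk 1; have h2 := hk 2
    rw [abs_le] at h0 h1 h2
    nlinarith [h0.1, h0.2, h1.1, h1.2, h2.1, h2.2]
  exact (pow_le_pow_iff_left₀ (norm_nonneg _) (by positivity) two_ne_zero).1 hsq

/-- Site-centred cell weights of a nonnegative weight are nonnegative. -/
theorem p1SiteW_nonneg (a h : ℝ) {g : (Fin 3 → ℝ) → ℝ} (hg0 : ∀ z, 0 ≤ g z) (p : ℤ × ℤ × ℤ) (i : (ℤ × ℤ × ℤ) × Fin 6) :
    0 ≤ p1SiteW a h g p i :=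
  setIntegral_nonneg (isClosed_p1RealCell a h i).measurableSet fun _ _ => hg0 _

/-- **DECAY OF THE MATCHED TABLE WEIGHTS**: for a weight `0 ≤ g(z) ≤ M·(S₁ + |z|²)⁻³` (the split weight: `M = 8`,
`chiSq_invPow_le`) there is `C` with `0 ≤ p1BondW W_p q d ≤ C·((1 + ‖y_q − y_p‖)⁻¹)⁶` for ALL sites `p, q` and bonds `d` — the decay
clause of `CoreJointCoercive` for the matched receipts table (`p1BondW_p1SiteW_eq_p1RecTable`).  NOT a proof of H12⋆, NOT summit
progress. -/
theorem p1BondW_p1SiteW_decay {a h : ℝ} (ha : 0 < a) (hh : 0 < h) {g : (Fin 3 → ℝ) → ℝ} {M S1 : ℝ} (hM : 0 ≤ M) (hS1 : 0 < S1)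
    (hgM : ∀ z, g z ≤ M * (S1 + fpSq z)⁻¹ ^ 3) (hg0 : ∀ z, 0 ≤ g z) :
    ∃ C : ℝ, ∀ p q d : ℤ × ℤ × ℤ, 0 ≤ p1BondW (p1SiteW a h g p) q d ∧
      p1BondW (p1SiteW a h g p) q d ≤ C * ((1 + ‖hcpSite a h q - hcpSite a h p‖)⁻¹) ^ 6 := by
  set c₀ : ℝ := 2 * |a| + |h| with hc₀
  set V : ℝ := √3 * a ^ 2 * h / 12 with hV
  set L : ℝ := max (2 * (1 + 4 * c₀) ^ 2 / S1) 8 with hL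
  have hc0 : 0 ≤ c₀ := by positivity
  have hV0 : 0 ≤ V := by positivity
  have hL8 : 8 ≤ L := le_max_right _ _
  have hL0 : 0 ≤ L := by linarith
  have hL1 : 2 * (1 + 4 * c₀) ^ 2 ≤ L * S1 := by
    have := le_max_left (2 * (1 + 4 * c₀) ^ 2 / S1) 8
    rw [← hL, div_le_iff₀ hS1] at this
    exact this
  refine ⟨240 * 8 * (V * M) * L ^ 3, fun p q d => ?_⟩
  have hW0 : ∀ i, 0 ≤ p1SiteW a h g p i := p1SiteW_nonneg a h hg0 p
  refine ⟨p1BondW_nonneg hW0 q d, ?_⟩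
  set r : ℝ := ‖(fun k => hcpSite a h q k) - (fun k => hcpSite a h p k)‖ with hr
  set ρ : ℝ := max (r - 2 * c₀) 0 with hρ
  have hρ0 : 0 ≤ ρ := le_max_right _ _
  have hrρ : r ≤ ρ + 2 * c₀ := by have := le_max_left (r - 2 * c₀) 0; rw [← hρ] at this; linarith
  -- cube bound for every cube, and the sharper one near `q`
  set B : ℤ × ℤ × ℤ → ℝ := fun n =>
    V * (M * (S1 + max (‖(fun k => hcpSite a h n k) - (fun k => hcpSite a h p k)‖ - c₀) 0 ^ 2)⁻¹ ^ 3) with hB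
  have hWB : ∀ n π, p1SiteW a h g p (n, π) ≤ B n := fun n π => p1SiteW_le ha hh hM hS1 hgM hg0 p n π
  have hBq : ∀ o ∈ p1Corners, B (q - o) ≤ V * (M * (S1 + ρ ^ 2)⁻¹ ^ 3) := by
    intro o ho
    have h1 := norm_sub_corner_ge a h p q o ho
    have hρ' : ρ ≤ max (‖(fun k => hcpSite a h (q - o) k) - (fun k => hcpSite a h p k)‖ - c₀) 0 :=
      max_le_max (by rw [← hr] at h1; linarith) le_rfl
    have hinv : (S1 + max (‖(fun k => hcpSite a h (q - o) k) - (fun k => hcpSite a h p k)‖ - c₀) 0 ^ 2)⁻¹ ≤ (S1 + ρ ^ 2)⁻¹ :=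
      inv_anti₀ (by positivity) (by nlinarith [pow_le_pow_left₀ hρ0 hρ' 2])
    exact mul_le_mul_of_nonneg_left (mul_le_mul_of_nonneg_left (pow_le_pow_left₀ (by positivity) hinv 3) hM) hV0
  have hsum : p1BondW (p1SiteW a h g p) q d ≤ 240 * 8 * (V * M) * (S1 + ρ ^ 2)⁻¹ ^ 3 := by
    refine (p1BondW_le_of_cellBound hW0 hWB q d).trans ?_
    have : ∑ o ∈ p1Corners, B (q - o) ≤ ∑ _o ∈ p1Corners, V * (M * (S1 + ρ ^ 2)⁻¹ ^ 3) := Finset.sum_le_sum hBq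
    rw [Finset.sum_const, nsmul_eq_mul, show (p1Corners.card : ℝ) = 8 by rfl] at this
    linarith
  -- compare `(S₁ + ρ²)⁻³` with `(1 + ‖y_q − y_p‖)⁻⁶`
  set R : ℝ := ‖hcpSite a h q - hcpSite a h p‖ with hR
  have hR0 : 0 ≤ R := norm_nonneg _
  have hR2 : R ≤ 2 * r := norm_hcpSite_sub_le_two_mul a h p q
  have hA : 0 < S1 + ρ ^ 2 := by positivity
  have hkey : (1 + R) ^ 2 ≤ L * (S1 + ρ ^ 2) := by
    have h1 : 1 + R ≤ (1 + 4 * c₀) + 2 * ρ := by linarith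
    have h2 : (1 + R) ^ 2 ≤ ((1 + 4 * c₀) + 2 * ρ) ^ 2 := pow_le_pow_left₀ (by linarith) h1 2
    have h3 : ((1 + 4 * c₀) + 2 * ρ) ^ 2 ≤ 2 * (1 + 4 * c₀) ^ 2 + 8 * ρ ^ 2 := by
      nlinarith [sq_nonneg ((1 + 4 * c₀) - 2 * ρ)]
    nlinarith [mul_le_mul_of_nonneg_right hL8 (sq_nonneg ρ)]
  have hcmp : (S1 + ρ ^ 2)⁻¹ ^ 3 ≤ L ^ 3 * (1 + R)⁻¹ ^ 6 := by
    have key : (1 + R) ^ 6 ≤ L ^ 3 * (S1 + ρ ^ 2) ^ 3 := by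
      calc (1 + R) ^ 6 = ((1 + R) ^ 2) ^ 3 := by ring
        _ ≤ (L * (S1 + ρ ^ 2)) ^ 3 := pow_le_pow_left₀ (by positivity) hkey 3
        _ = L ^ 3 * (S1 + ρ ^ 2) ^ 3 := by ring
    rw [inv_pow, inv_pow, ← one_div, ← div_eq_mul_inv, div_le_div_iff₀ (by positivity) (by positivity)]
    linarith
  calc p1BondW (p1SiteW a h g p) q d ≤ 240 * 8 * (V * M) * (S1 + ρ ^ 2)⁻¹ ^ 3 := hsum
    _ ≤ 240 * 8 * (V * M) * (L ^ 3 * (1 + R)⁻¹ ^ 6) := mul_le_mul_of_nonneg_left hcmp (by positivity)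
    _ = 240 * 8 * (V * M) * L ^ 3 * (1 + R)⁻¹ ^ 6 := by ring

/-- **Instance: the ledger's split weight.**  For `W_p(i) = ∫_{cell i} χ(y − y_p)²|y − y_p|⁻⁶`, `χ = fpChi R₁² R₂²` (`0 < R₁ < R₂`), the
matched table weights decay like `(1 + ‖y_q − y_p‖)⁻⁶`.  NOT a proof of H12⋆, NOT summit progress. -/
theorem p1BondW_fpChi_decay {a h : ℝ} (ha : 0 < a) (hh : 0 < h) {R1 R2 : ℝ} (hR1 : 0 < R1) (hR12 : R1 < R2) :
    ∃ C : ℝ, ∀ p q d : ℤ × ℤ × ℤ,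
      0 ≤ p1BondW (p1SiteW a h (fun z => fpChi (R1 ^ 2) (R2 ^ 2) z ^ 2 * (fpSq z)⁻¹ ^ 3) p) q d ∧
      p1BondW (p1SiteW a h (fun z => fpChi (R1 ^ 2) (R2 ^ 2) z ^ 2 * (fpSq z)⁻¹ ^ 3) p) q d ≤
        C * ((1 + ‖hcpSite a h q - hcpSite a h p‖)⁻¹) ^ 6 := by
  have h1 : 0 < R1 ^ 2 := by positivity
  have hlt : R1 ^ 2 < R2 ^ 2 := by nlinarith
  exact p1BondW_p1SiteW_decay ha hh (by norm_num : (0 : ℝ) ≤ 8) h1 (chiSq_invPow_le h1 hlt)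
    fun z => mul_nonneg (sq_nonneg _) (pow_nonneg (inv_nonneg.2 (fpSq_nonneg _)) _)

end Summit.AtomisticToContinuum.Crystallization.Theorems.StrictSplittingRuleBirth
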